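import Literature.NumberTheory.GaloisRepresentations.ConjugationDescent
import Literature.NumberTheory.GaloisRepresentations.AbsGaloisGroupProofs
import Literature.NumberTheory.EllipticCurves.KummerSelmerStructure
import HarnessLib

/-!
# Model transport in local Galois cohomology, I: `H¹(Γ_{E'}, M) → H¹(Γ_E, M)` along a `K`-algebra
# map `E' → E` — injective when `Γ_E → Γ_{E'}` is onto, compatible with restriction from `K`
# (cell `b2b-bsdres`, CLASS-CLOSURE lane, class O10 — x1b GEN 41, class lead; file 101 of the series)

HONEST FRAMING (cell `b2b-bsdres`, run/shared/lean/b2b/bsd-rank1-residual/, verbatim in every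
file): the goal of the cell is to DELETE the COMBINATION-SHAPED residual classes of the
Birch–Swinnerton-Dyer formula for ALL analytic-rank `≤ 1` elliptic curves over `ℚ` — "full BSD
formula for every rank `≤ 1` curve in class `C`" assembled STRICTLY from published theorems — so
that the rank-`≤ 1` remainder becomes exactly the CONSTRUCTION-SHAPED classes, which are TYPED
(missing-input `Prop`s), NOT attempted. This is not "finishing BSD". CLASS-CLOSURE lane: prove
what is provable now; shrink each hard class to its core with data; no claim beyond stated classes;
research routes on CONSTRUCTION-SHAPED X12 / O10; census / instrument output = EVIDENCE / conjecture
items, NEVER a Literature fact; `RESIDUAL-MAP.md` marks change only by signed lines. THIS FILE: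
TOOL THEOREMS ONLY — no definition, no named Literature fact, no `sorry`, axioms standard; nothing
is booked; no label / mark / count / sub-cell moves; (C1_η), (C2_η-GZ), (C3_η) stay typed as filed
(cc-typer-6's pen); nothing about `BSD(W, p)` of any pair is claimed.

## Why (x1b GEN 39 note §3 (iv) / GEN 40 §3: the model transport `ℚ_[p] ⇄ ℚ_{v₀}`)

x1b's B3 (files 79–98) lives at the model `E = ℚ_[p]` (`GaloisRep.restrictField ℚ_[p]`), the
count (C) (files 63–69, 77, 99, 100) at the completion `E' = ℚ_{v₀} = v₀.adicCompletion ℚ`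
(`GaloisRep.toLocal`). The two are isomorphic `ℚ`-algebras (Mathlib `Padic.adicCompletionEquiv`),
but the tree's local cohomology `H¹(Γ_E, M)` depends on the model through `Γ_E = Gal(Ē/E)` and the
CHOSEN embedding `K̄ → Ē` (`absClosureEmbedding`, up to conjugation: `AbsGaloisGroupProofs`). This
file is the generic transport along a `K`-algebra map `E' → E`:

* §1 `absGaloisRestrict_surjective_of_surjective` — if `E' → E` is onto (an isomorphism) then the
  restriction `r : Γ_E → Γ_{E'}` is onto.
* §2 `exists_smul_absClosureEmbedding_eq` — a `τ ∈ Γ_K` with `ι_E ∘ τ = j ∘ ι_{E'}` on `K̄`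
  (`j : Ē' → Ē` the chosen `E'`-embedding; uniqueness of algebraic closures,
  `exists_absClosureEmbedding_comp_eq`), hence `res_{E'}(r σ) = τ⁻¹ · res_E(σ) · τ`
  (`absGaloisRestrict_absGaloisRestrict_eq_conj`).
* §3 **`exists_transportH1`** — for a discrete `Γ_K`-module `M` there is an additive map
  `Θ : H¹(Γ_{E'}, M) → H¹(Γ_E, M)` (pull back along `r`, twist the coefficients by `τ`) with:
  `Θ ∘ res_{E'} = res_E` on `H¹(K, M)` (inner automorphisms act trivially, the tree's
  `map_eq_map_of_inner_one`); on cocycles `Θ[ψ] = [σ ↦ τ · ψ(r σ)]`; `Θ` injective once `r` is onto.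

File 102 adds the compatibility with Kummer classes and with the `ℤ_p`-tower conditions for
`M = E[p^m]`, and the application `ℚ_{v₀} → ℚ_[p]`.

References: [SerreLocalFields1979] VII §5 Prop. 3; [SerreGaloisCohomology1997] I §2.4, II §1.1;
[MilneFT2022] Ch. 6–7 (algebraic closures unique up to isomorphism; `Γ_F` up to inner automorphism).
-/

noncomputable section

open scoped Classical

open Field CategoryTheory

namespace Summit.BirchSwinnertonDyer.Rank1Residual.Additive.LocalModelTransport

open Literature.NumberTheory.GaloisRepresentations
open scoped ContRepresentation

universe u

/-! ## §1 Surjectivity of `Γ_E → Γ_{E'}` for an isomorphism `E' → E` -/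

section Surj

variable (E' E : Type u) [Field E'] [Field E] [Algebra E' E]

/-- **If the `E'`-algebra map `E' → E` is onto, the restriction `Γ_E → Γ_{E'}` is onto**: for
`τ' ∈ Γ_{E'}` the automorphism `j ∘ τ' ∘ j⁻¹` of `Ē` (`j : Ē' ≃ Ē` the chosen embedding, bijective
since `E/E'` is algebraic) is `E`-linear and restricts to `τ'`. [cite: MilneFT2022, Ch. 7 (restriction to the algebraic closure)] -/
theorem absGaloisRestrict_surjective_of_surjective [Algebra.IsAlgebraic E' E]
    (h : Function.Surjective (algebraMap E' E)) :
    Function.Surjective (absGaloisRestrict E' E) := by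
  intro τ'
  let j : AlgebraicClosure E' ≃ₐ[E'] AlgebraicClosure E := absClosureEquiv E' E
  let e : AlgebraicClosure E ≃+* AlgebraicClosure E :=
    (j.symm.trans ((show AlgebraicClosure E' ≃ₐ[E'] AlgebraicClosure E' from τ').trans j)).toRingEquiv
  have he : ∀ x : E, e (algebraMap E (AlgebraicClosure E) x) = algebraMap E (AlgebraicClosure E) x := by
    intro x
    obtain ⟨y, rfl⟩ := h x
    rw [← IsScalarTower.algebraMap_apply E' E (AlgebraicClosure E)]
    change j ((show AlgebraicClosure E' ≃ₐ[E'] AlgebraicClosure E' from τ')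
      (j.symm (algebraMap E' (AlgebraicClosure E) y))) = _
    rw [j.symm.commutes, AlgEquiv.commutes, j.commutes]
  let σ : absoluteGaloisGroup E := AlgEquiv.ofRingEquiv (f := e) he
  refine ⟨σ, ?_⟩
  apply AlgEquiv.ext
  intro x
  have h1 := absGaloisRestrict_apply_smul E' E σ x
  have h2 : σ • absClosureEmbedding E' E x =
      absClosureEmbedding E' E ((show AlgebraicClosure E' ≃ₐ[E'] AlgebraicClosure E' from τ') x) := by
    change e (j x) = j (_)
    change j ((show AlgebraicClosure E' ≃ₐ[E'] AlgebraicClosure E' from τ') (j.symm (j x))) = _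
    rw [j.symm_apply_apply]
  rw [h2] at h1
  exact (absClosureEmbedding E' E).injective h1

end Surj

/-! ## §2 The comparison element `τ ∈ Γ_K` -/

section Tau

variable (K E' E : Type u) [Field K] [Field E'] [Field E] [Algebra K E'] [Algebra K E] [Algebra E' E]
  [IsScalarTower K E' E]

/-- **`ι_E ∘ τ = j ∘ ι_{E'}` for some `τ ∈ Γ_K`**: the two `K`-embeddings `ι_E : K̄ → Ē` and
`j ∘ ι_{E'} : K̄ → Ē' → Ē` differ by an automorphism of `K̄` (uniqueness of the algebraic closure up
to `K`-isomorphism, the tree's `exists_absClosureEmbedding_comp_eq`).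
[cite: MilneFT2022, Ch. 6 Thm 6.8 and Rmk 6.9 (v4.60)] -/
theorem exists_smul_absClosureEmbedding_eq :
    ∃ τ : absoluteGaloisGroup K, ∀ x : AlgebraicClosure K,
      absClosureEmbedding K E (τ • x) = absClosureEmbedding E' E (absClosureEmbedding K E' x) :=
  exists_absClosureEmbedding_comp_eq K E
    (((absClosureEmbedding E' E).restrictScalars K).comp (absClosureEmbedding K E'))

omit [IsScalarTower K E' E] in
/-- **`res_{E'}(r σ) = τ⁻¹ · res_E(σ) · τ`** for every `σ ∈ Γ_E`, where `r : Γ_E → Γ_{E'}` and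
`res_E : Γ_E → Γ_K`, `res_{E'} : Γ_{E'} → Γ_K` are the tree's restrictions and `τ` is the comparison
element of `exists_smul_absClosureEmbedding_eq` (apply `ι_E`, which is injective, and use the three
equivariances `ι (res σ • x) = σ • ι x`). [cite: MilneFT2022, Ch. 7 fn. 4 (Γ_F up to inner automorphism)] -/
theorem absGaloisRestrict_absGaloisRestrict_eq_conj {τ : absoluteGaloisGroup K}
    (hτ : ∀ x : AlgebraicClosure K,
      absClosureEmbedding K E (τ • x) = absClosureEmbedding E' E (absClosureEmbedding K E' x))
    (σ : absoluteGaloisGroup E) :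
    absGaloisRestrict K E' (absGaloisRestrict E' E σ) = τ⁻¹ * absGaloisRestrict K E σ * τ := by
  have key : τ * absGaloisRestrict K E' (absGaloisRestrict E' E σ) = absGaloisRestrict K E σ * τ := by
    refine FaithfulSMul.eq_of_smul_eq_smul (α := AlgebraicClosure K) fun x => ?_
    apply (absClosureEmbedding K E).toRingHom.injective
    change absClosureEmbedding K E ((τ * absGaloisRestrict K E' (absGaloisRestrict E' E σ)) • x) =
      absClosureEmbedding K E ((absGaloisRestrict K E σ * τ) • x)
    rw [mul_smul, mul_smul, hτ, absGaloisRestrict_apply_smul, absGaloisRestrict_apply_smul,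
      absGaloisRestrict_apply_smul, hτ]
  rw [mul_assoc, ← key, inv_mul_cancel_left]

end Tau

/-! ## §3 The transport `Θ : H¹(Γ_{E'}, M) → H¹(Γ_E, M)` -/

section Transport

variable {K : Type u} [Field K] {M : Type u} [AddCommGroup M] [TopologicalSpace M] [DiscreteTopology M]
  (ρ : DiscreteGaloisModule K M) (E' E : Type u) [Field E'] [Field E] [Algebra K E'] [Algebra K E]
  [Algebra E' E]

/-- **The transport `Θ : H¹(Γ_{E'}, M) → H¹(Γ_E, M)`** along a `K`-algebra map `E' → E`, for a
discrete `Γ_K`-module `M` and a comparison element `τ ∈ Γ_K` with `res_{E'}(r σ) = τ⁻¹ res_E(σ) τ`: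
an additive map with (i) `Θ ∘ res_{E'} = res_E` on `H¹(K, M)` (inner automorphisms act trivially:
the tree's `map_eq_map_of_inner_one`), (ii) on cocycles `Θ[ψ] = [σ ↦ τ · ψ(r σ)]`, and (iii) `Θ`
injective as soon as `r : Γ_E → Γ_{E'}` is onto. (`Θ` = pull back along `r` with the coefficient
map `v ↦ τ v`.) [cite: SerreLocalFields1979, VII §5 Prop. 3] [cite: SerreGaloisCohomology1997, I §2.4] -/
theorem exists_transportH1 {τ : absoluteGaloisGroup K}
    (hτ : ∀ σ : absoluteGaloisGroup E,
      absGaloisRestrict K E' (absGaloisRestrict E' E σ) = τ⁻¹ * absGaloisRestrict K E σ * τ) :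
    ∃ Θ : galoisCohomology (GaloisRep.restrictField E' ρ) 1 →+ galoisCohomology (GaloisRep.restrictField E ρ) 1,
      (∀ c : galoisCohomology ρ 1,
          Θ (galoisCohomology.res ρ E' 1 c) = galoisCohomology.res ρ E 1 c) ∧
      (∀ ψ : contOneCocycles (DiscreteGaloisModule.toTopRep (GaloisRep.restrictField E' ρ)),
          ∃ φ : contOneCocycles (DiscreteGaloisModule.toTopRep (GaloisRep.restrictField E ρ)),
            oneCocycleClass _ φ = Θ (oneCocycleClass _ ψ) ∧
            ∀ σ : absoluteGaloisGroup E, φ.1 σ = ρ τ (ψ.1 (absGaloisRestrict E' E σ))) ∧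
      (Function.Surjective (absGaloisRestrict E' E) → Function.Injective Θ) := by
  -- the coefficient map `v ↦ τ v` as a morphism `res r X' ⟶ Y`
  set X' := DiscreteGaloisModule.toTopRep (GaloisRep.restrictField E' ρ) with hX'
  set Y := DiscreteGaloisModule.toTopRep (GaloisRep.restrictField E ρ) with hY
  set r := absGaloisRestrict E' E with hr
  -- `τ (τ⁻¹ w) = w`, `τ⁻¹ (τ w) = w`
  have hττ : ∀ w : M, ρ τ (ρ τ⁻¹ w) = w := fun w => by
    rw [← Module.End.mul_apply, ← map_mul, mul_inv_cancel, map_one, Module.End.one_apply]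
  have hτ'τ : ∀ w : M, ρ τ⁻¹ (ρ τ w) = w := fun w => by
    rw [← Module.End.mul_apply, ← map_mul, inv_mul_cancel, map_one, Module.End.one_apply]
  have hconj : ∀ (g : absoluteGaloisGroup E) (v : M),
      ρ τ (ρ (absGaloisRestrict K E' (r g)) v) = ρ (absGaloisRestrict K E g) (ρ τ v) := by
    intro g v
    rw [hτ g, map_mul, map_mul, Module.End.mul_apply, Module.End.mul_apply, hττ]
  have hint : ∀ g : absoluteGaloisGroup E,
      ρ.toContRepresentation τ ∘L
          (TopRep.res (r : absoluteGaloisGroup E →* absoluteGaloisGroup E') X').ρ g =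
        Y.ρ g ∘L ρ.toContRepresentation τ := by
    intro g
    ext v
    exact hconj g v
  set f₁ : TopRep.res (r : absoluteGaloisGroup E →* absoluteGaloisGroup E') X' ⟶ Y :=
    TopRep.ofHom ⟨ρ.toContRepresentation τ, hint⟩ with hf₁
  set Θ : galoisCohomology (GaloisRep.restrictField E' ρ) 1 →+
      galoisCohomology (GaloisRep.restrictField E ρ) 1 :=
    (ContinuousCohomology.map r f₁ 1).hom.toLinearMap.toAddMonoidHom with hΘ
  have hΘclass : ∀ ψ : contOneCocycles X',
      Θ (oneCocycleClass X' ψ) = oneCocycleClass Y (contOneCocycles.pullback r f₁ ψ) := fun ψ =>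
    map_oneCocycleClass _ r f₁ ψ
  refine ⟨Θ, fun c => ?_, fun ψ => ⟨contOneCocycles.pullback r f₁ ψ, (hΘclass ψ).symm, fun σ => rfl⟩,
    fun hsurj => ?_⟩
  · -- (i) `Θ ∘ res_{E'} = res_E`: inner automorphisms act trivially
    obtain ⟨φ, rfl⟩ := oneCocycleClass_surjective ρ.toTopRep c
    rw [galoisCohomology.res_one_oneCocycleClass, galoisCohomology.res_one_oneCocycleClass, hΘclass]
    have hθ : ∀ x : absoluteGaloisGroup E,
        ((absGaloisRestrict K E').comp r) x = τ⁻¹ * absGaloisRestrict K E x * τ := fun x => hτ x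
    have hint' : ∀ g : absoluteGaloisGroup E,
        ρ.toContRepresentation τ ∘L (TopRep.res (((absGaloisRestrict K E').comp r :
            absoluteGaloisGroup E →ₜ* absoluteGaloisGroup K) :
            absoluteGaloisGroup E →* absoluteGaloisGroup K) ρ.toTopRep).ρ g =
          Y.ρ g ∘L ρ.toContRepresentation τ := by
      intro g
      ext v
      exact hconj g v
    have key := map_eq_map_of_inner_one (X := ρ.toTopRep) (Y := Y) τ (absGaloisRestrict K E)
      ((absGaloisRestrict K E').comp r) hθ (TopRep.ofHom ⟨ρ.toContRepresentation τ, hint'⟩)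
      (TopRep.ofHom ⟨ContinuousLinearMap.id ℤ M, fun _ => rfl⟩) (fun v => rfl) (oneCocycleClass _ φ)
    rw [map_oneCocycleClass, map_oneCocycleClass] at key
    refine Eq.trans ?_ key
    exact congrArg (oneCocycleClass Y) (Subtype.ext (ContinuousMap.ext fun σ => rfl))
  · -- (iii) injectivity when `r` is onto
    refine (injective_iff_map_eq_zero Θ).mpr fun y hy => ?_
    obtain ⟨ψ, rfl⟩ := oneCocycleClass_surjective X' y
    rw [hΘclass] at hy
    obtain ⟨v, hv⟩ := (oneCocycleClass_eq_zero_iff Y _).mp hy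
    -- `τ ψ(r σ) = σ v - v`, so `ψ(t') = t' (τ⁻¹ v) - τ⁻¹ v` for every `t' = r σ`
    refine (oneCocycleClass_eq_zero_iff X' ψ).mpr ⟨ρ τ⁻¹ v, fun t' => ?_⟩
    obtain ⟨σ, rfl⟩ := hsurj t'
    have h := hv σ
    change ρ τ (ψ.1 (r σ)) = ρ (absGaloisRestrict K E σ) v - v at h
    change ψ.1 (r σ) = ρ (absGaloisRestrict K E' (r σ)) (ρ τ⁻¹ v) - ρ τ⁻¹ v
    rw [← hτ'τ (ψ.1 (r σ)), h, map_sub, hτ σ, map_mul, map_mul, Module.End.mul_apply,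
      Module.End.mul_apply, hττ]

end Transport

end Summit.BirchSwinnertonDyer.Rank1Residual.Additive.LocalModelTransport

end
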